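import Mathlib
import Summits.AtomisticToContinuum.Crystallization.Theses.ThreeConeCertificate
import Summits.AtomisticToContinuum.Crystallization.Theses.BraggSlacknessRigidity
import Literature.MathematicalPhysics.StatisticalMechanics.LennardJonesClusters

/-!
# An exact three-cone certificate gives the Kepler bound for Lennard-Jones

Route `ThreeConeCertificate` (sub-problem `Crystallization`), item `stmt-AtomisticToContinuum-11962`
(`CertificateBound := ExactCertificate → KeplerBound`), the glue step of the Fisher–Ruelle-type
stability argument (Ruelle 1969, §3.2) with a third cone. The item is shared verbatim with route
`BraggSlacknessRigidity`; both route decls are settled here (`certificateBound_proof`,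
`braggSlacknessRigidity_certificateBound_proof`) from one inequality,
`neg_mul_le_interactionEnergy_of_threeCone`, stated for a general pair potential in `ℝᵈ`.

PROOF. Let `P, ρ, c, g, U, f` be an exact certificate: `V_LJ = g + U + f` on `(0, ∞)`, `U ≥ 0` on
`(0, ∞)`, `f` of positive type (all finite quadratic forms `∑ᵢ ∑ⱼ wᵢ wⱼ f(|yᵢ - yⱼ|) ≥ 0`),
`g` `c`-stable on injective configurations (`-cN ≤ ∑_{i<j} g`), and `c + f(0)/2 = -e(P)`.
Fix an injective configuration `x` of `N` points. All pair distances `|xᵢ - xⱼ|`, `i < j`, are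
positive, so the split holds termwise and
`𝓔_{V_LJ}(x) = 𝓔_g(x) + 𝓔_U(x) + 𝓔_f(x)` (`interactionEnergy_eq_add_add_of_injective`);
`𝓔_U(x) ≥ 0` termwise; the quadratic form with `w ≡ 1`, `y = x` is
`∑ᵢ ∑ⱼ f(|xᵢ - xⱼ|) = N f(0) + 2 𝓔_f(x) ≥ 0` (diagonal terms `f(0)`, `two_mul_interactionEnergy`);
stability gives `𝓔_g(x) ≥ -cN`. Adding, `𝓔_{V_LJ}(x) ≥ -cN - N f(0)/2 = N e(P)`.
-/

noncomputable section

namespace Summit.AtomisticToContinuum.Crystallization.Theorems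

open Summit.AtomisticToContinuum.Crystallization.Theses
open Literature.MathematicalPhysics.StatisticalMechanics

/-- Off-diagonal pair distances of an injective configuration are positive: for `j ∈ Finset.Ioi i`
(i.e. `i < j`), `0 < |xᵢ - xⱼ|`. -/
theorem dist_pos_of_injective_of_mem_Ioi {N d : ℕ} {x : Fin N → EuclideanSpace ℝ (Fin d)}
    (hx : Function.Injective x) {i j : Fin N} (hj : j ∈ Finset.Ioi i) :
    0 < dist (x i) (x j) :=
  dist_pos.2 fun h => (ne_of_lt (Finset.mem_Ioi.1 hj)) (hx h)

/-- Termwise splitting of the interaction energy: if `V = g + U + f` on `(0, ∞)` and `x` is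
injective, then `𝓔_V(x) = 𝓔_g(x) + 𝓔_U(x) + 𝓔_f(x)`. -/
theorem interactionEnergy_eq_add_add_of_injective {N d : ℕ} {V g U f : ℝ → ℝ}
    (hsplit : ∀ r : ℝ, 0 < r → V r = g r + U r + f r)
    {x : Fin N → EuclideanSpace ℝ (Fin d)} (hx : Function.Injective x) :
    interactionEnergy V x = interactionEnergy g x + interactionEnergy U x + interactionEnergy f x := by
  unfold interactionEnergy
  rw [← Finset.sum_add_distrib, ← Finset.sum_add_distrib]
  refine Finset.sum_congr rfl fun i _ => ?_
  rw [← Finset.sum_add_distrib, ← Finset.sum_add_distrib]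
  exact Finset.sum_congr rfl fun j hj => hsplit _ (dist_pos_of_injective_of_mem_Ioi hx hj)

/-- A potential nonnegative on `(0, ∞)` has nonnegative interaction energy on every injective
configuration. -/
theorem interactionEnergy_nonneg_of_injective {N d : ℕ} {U : ℝ → ℝ}
    (hU : ∀ r : ℝ, 0 < r → 0 ≤ U r)
    {x : Fin N → EuclideanSpace ℝ (Fin d)} (hx : Function.Injective x) :
    0 ≤ interactionEnergy U x :=
  Finset.sum_nonneg fun _ _ => Finset.sum_nonneg fun _ hj =>
    hU _ (dist_pos_of_injective_of_mem_Ioi hx hj)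

/-- The full double sum, diagonal included, is `N f(0)` plus twice the interaction energy:
`∑ᵢ ∑ⱼ f(|xᵢ - xⱼ|) = N f(0) + 2 𝓔_f(x)`. -/
theorem sum_sum_eq_card_mul_add_two_mul_interactionEnergy {N d : ℕ} (f : ℝ → ℝ)
    (x : Fin N → EuclideanSpace ℝ (Fin d)) :
    ∑ i, ∑ j, f (dist (x i) (x j)) = (N : ℝ) * f 0 + 2 * interactionEnergy f x := by
  rw [two_mul_interactionEnergy]
  have h : ∀ i : Fin N, ∑ j, f (dist (x i) (x j)) = f 0 + siteEnergy f x i := fun i => by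
    unfold siteEnergy
    rw [← Finset.add_sum_erase Finset.univ _ (Finset.mem_univ i), dist_self]
  simp only [h, Finset.sum_add_distrib, Finset.sum_const, Finset.card_univ, Fintype.card_fin,
    nsmul_eq_mul]

/-- **Three-cone certificate bound** (the inequality behind `CertificateBound`, with the data of a
certificate as explicit hypotheses): if `V = g + U + f` on `(0, ∞)` with `U ≥ 0` there, `f` of
positive type (finite quadratic forms nonnegative) and `g` `c`-stable on injective configurations,
then `-(c + f(0)/2) · N ≤ 𝓔_V(x)` for every injective configuration `x` of `N` points in `ℝᵈ`.
(Fisher–Ruelle stability with a third cone; Ruelle 1969, §3.2.) -/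
theorem neg_mul_le_interactionEnergy_of_threeCone {d : ℕ} {V g U f : ℝ → ℝ} {c : ℝ}
    (hsplit : ∀ r : ℝ, 0 < r → V r = g r + U r + f r)
    (hU : ∀ r : ℝ, 0 < r → 0 ≤ U r)
    (hf : ∀ (n : ℕ) (y : Fin n → EuclideanSpace ℝ (Fin d)) (w : Fin n → ℝ),
      0 ≤ ∑ i, ∑ j, w i * w j * f (dist (y i) (y j)))
    (hstab : ∀ (N : ℕ) (x : Fin N → EuclideanSpace ℝ (Fin d)), Function.Injective x →
      -(c * (N : ℝ)) ≤ interactionEnergy g x)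
    {N : ℕ} {x : Fin N → EuclideanSpace ℝ (Fin d)} (hx : Function.Injective x) :
    -((c + f 0 / 2) * (N : ℝ)) ≤ interactionEnergy V x := by
  have hE := interactionEnergy_eq_add_add_of_injective hsplit hx
  have hEU : 0 ≤ interactionEnergy U x := interactionEnergy_nonneg_of_injective hU hx
  have hB : 0 ≤ ∑ i, ∑ j, f (dist (x i) (x j)) := by
    simpa only [one_mul] using hf N x (fun _ => 1)
  have hdiag := sum_sum_eq_card_mul_add_two_mul_interactionEnergy f x
  have hEg := hstab N x hx
  have hring : -((c + f 0 / 2) * (N : ℝ)) = -(c * (N : ℝ)) - (N : ℝ) * f 0 / 2 := by ring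
  rw [hE, hring]
  linarith

/-- Settles `stmt-AtomisticToContinuum-11962` (`ThreeConeCertificate.CertificateBound`): an exact
three-cone certificate `(P, ρ, c, g, U, f)` for the Lennard-Jones potential gives the Kepler bound
`N · e(P) ≤ 𝓔_N(x)` for every injective configuration `x`, with the same periodic `P`
(by `neg_mul_le_interactionEnergy_of_threeCone` and `c + f(0)/2 = -e(P)`). -/
theorem certificateBound_proof : ThreeConeCertificate.CertificateBound := by
  unfold ThreeConeCertificate.CertificateBound ThreeConeCertificate.ExactCertificate
    ThreeConeCertificate.KeplerBound
  rintro ⟨P, ρ, c, g, U, f, hsplit, hU, -, hf, hstab, hc⟩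
  refine ⟨P, fun N x hx => ?_⟩
  have hc' : P.energyPerParticle lennardJones = -(c + f 0 / 2) := by linarith
  calc (N : ℝ) * P.energyPerParticle lennardJones = -((c + f 0 / 2) * (N : ℝ)) := by
        rw [hc']; ring
    _ ≤ interactionEnergy lennardJones x :=
        neg_mul_le_interactionEnergy_of_threeCone hsplit hU hf hstab hx

/-- The same item as wanted by route `BraggSlacknessRigidity` (verbatim twin decl
`BraggSlacknessRigidity.CertificateBound := ExactCertificate → KeplerBound` of that route file):
an exact three-cone certificate gives the Kepler bound. -/
theorem braggSlacknessRigidity_certificateBound_proof :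
    BraggSlacknessRigidity.CertificateBound := by
  unfold BraggSlacknessRigidity.CertificateBound BraggSlacknessRigidity.ExactCertificate
    BraggSlacknessRigidity.KeplerBound
  rintro ⟨P, ρ, c, g, U, f, hsplit, hU, -, hf, hstab, hc⟩
  refine ⟨P, fun N x hx => ?_⟩
  have hc' : P.energyPerParticle lennardJones = -(c + f 0 / 2) := by linarith
  calc (N : ℝ) * P.energyPerParticle lennardJones = -((c + f 0 / 2) * (N : ℝ)) := by
        rw [hc']; ring
    _ ≤ interactionEnergy lennardJones x :=
        neg_mul_le_interactionEnergy_of_threeCone hsplit hU hf hstab hx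

end Summit.AtomisticToContinuum.Crystallization.Theorems

end
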